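import Mathlib
import Summits.ValiantsHypothesis.ValiantsHypothesis.Theorems.FifoMatchingNNLinearDegreeCofactorHardQueueTransferS
import HarnessLib

/-!
# Crux `NNLinearDegreeCofactorHard` (stmt-ValiantsHypothesis-23918), line `internal_cofactor`: the DICHOTOMY on the abstract
# queue history (unit U4 of (D*)): many S-boundaries, or many tests

Generations `T₀ = A, …, T_m` (`…QueueGenerations`), S-items `isS`, colours `σ ∘ o`.  Hypotheses: NS (an S-push has an
S-front), the S-BAND (`sPush ≤ sPop + D` on every window of every generation; `Zmin ≤ #alive S-items ≤ Zmax` at every `T_j`) and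
FREE MASS (each colour owns `≥ Q` S-items among `[rC A, rO T_m)`, unit U2).  Let `Sbd` be the number of S-BOUNDARIES (S-items whose
colour differs from their S-predecessor's) in `(rC A, rO T_m)` and `tests` the test pushes of `[A, T_m)`.  Then

  `dichotomy`:   `Q ≤ Zmax · Sbd`   or   `Zmin ≤ tests + D · (2·Sbd + 1)`.

Proof: if some colour is present among the alive S-items at EVERY `T_j`, the other colour's `≥ Q` S-items are spread over
generations holding `≤ Zmax` of them each, and every such generation has both colours hence an S-boundary inside
(`exists_sboundary_between`, pigeonhole `card_filter_le_mul_card_gens`, `sum_card_boundaries_le`).  Otherwise both «all-`b`» and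
«all-`¬b`» moments exist; between a LAST all-`¬b` moment and the NEXT all-`b` moment both colours are present, and summing
`growthS_le` over those generations gives the second alternative (the TRANSFER COST).  Deterministic; nothing here proves S2b,
the crux or VP ≠ VNP (not proved). [folklore]
-/

-- Sub = Summit single-conjunct layout: the duplicated namespace component is mandated by the tree.
set_option linter.dupNamespace false

namespace Summit.ValiantsHypothesis.ValiantsHypothesis.Theorems.FifoMatching.NNLinearDegreeCofactorHard.QueueHistory

open Finset
open Summit.ValiantsHypothesis.ValiantsHypothesis.Theorems.FifoMatching.NNMonotoneHard

/-- Alive S-items at time `T`. [folklore] -/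
def sAlive (rO rC : ℕ → ℕ) (isS : ℕ → Bool) (T : ℕ) : ℕ :=
  ((Ico (rC T) (rO T)).filter fun k => isS k = true).card

/-- S-BOUNDARIES in the index interval `(lo, hi)`: S-items whose colour differs from their S-predecessor's. [folklore] -/
def sBd (σ : ℕ → Bool) (o : ℕ → ℕ) (isS : ℕ → Bool) (lo hi : ℕ) : ℕ :=
  ((Ioo lo hi).filter fun k => isS k = true ∧
    σ (o k) ≠ σ (o (Nat.findGreatest (fun n => isS n = true) (k - 1)))).card

section AbstractQueue

variable {W σ : ℕ → Bool} {rO rC o c : ℕ → ℕ} {n' : ℕ} {isS : ℕ → Bool}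
variable (hOs : ∀ t, rO (t + 1) = rO t + (if W t = true then 1 else 0))
  (hCs : ∀ t, rC (t + 1) = rC t + (if W t = true then 0 else 1))
  (ho : ∀ k t, k < n' → (o k < t ↔ k < rO t))
  (hc : ∀ k t, k < n' → (c k < t ↔ k < rC t))

/-- Alive S-items split by colour. [folklore] -/
theorem aliveS_add_aliveS (b : Bool) (T : ℕ) :
    aliveS σ rO rC o (fun k => !isS k) b T + aliveS σ rO rC o (fun k => !isS k) (!b) T = sAlive rO rC isS T := by
  classical
  unfold aliveS sAlive
  rw [← card_union_of_disjoint]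
  · congr 1
    ext k
    simp only [mem_union, mem_filter, Bool.not_eq_false']
    constructor
    · rintro (⟨hk, hS, _⟩ | ⟨hk, hS, _⟩) <;> exact ⟨hk, hS⟩
    · rintro ⟨hk, hS⟩
      by_cases h : σ (o k) = b
      · exact Or.inl ⟨hk, hS, h⟩
      · exact Or.inr ⟨hk, hS, by cases b <;> simpa using h⟩
  · exact disjoint_filter.2 fun k _ h1 h2 => by
      rw [h1.2] at h2; exact Bool.not_ne_self b h2.2.symm

/-- **Both colours among the alive S-items give an S-boundary strictly inside the alive interval.** [folklore] -/
theorem one_le_sBd_of_two_colours {T : ℕ} (b : Bool)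
    (hb : 0 < aliveS σ rO rC o (fun k => !isS k) b T) (hb' : 0 < aliveS σ rO rC o (fun k => !isS k) (!b) T) :
    1 ≤ sBd σ o isS (rC T) (rO T) := by
  classical
  unfold aliveS at hb hb'
  obtain ⟨k₁, hk₁⟩ := card_pos.1 hb
  obtain ⟨k₂, hk₂⟩ := card_pos.1 hb'
  rw [mem_filter, mem_Ico, Bool.not_eq_false'] at hk₁ hk₂
  have hne : σ (o k₁) ≠ σ (o k₂) := by rw [hk₁.2.2, hk₂.2.2]; exact Bool.self_ne_not b
  unfold sBd
  rw [Nat.one_le_iff_ne_zero, Ne, card_eq_zero, ← Ne, ← nonempty_iff_ne_empty]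
  rcases lt_or_gt_of_ne (fun h : k₁ = k₂ => hne (h ▸ rfl)) with hlt | hlt
  · obtain ⟨j', h1, h2, h3, h4, h5⟩ := exists_sboundary_between isS (fun k => σ (o k)) hk₁.2.1 k₂ hlt hk₂.2.1 hne
    exact ⟨j', mem_filter.2 ⟨mem_Ioo.2 ⟨by omega, by omega⟩, h3, h5⟩⟩
  · obtain ⟨j', h1, h2, h3, h4, h5⟩ := exists_sboundary_between isS (fun k => σ (o k)) hk₂.2.1 k₁ hlt hk₁.2.1 hne.symm
    exact ⟨j', mem_filter.2 ⟨mem_Ioo.2 ⟨by omega, by omega⟩, h3, h5⟩⟩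

include hOs hCs hc in
/-- **Persistent colour ⇒ many S-boundaries.**  If colour `b` is present among the alive S-items at every generation time
`T_j` (`j ≤ m`), at most `Zmax` S-items are alive at each `T_j`, and the other colour owns `≥ Q` S-items in `[rC A, rO T_m)`, then
`Q ≤ Zmax · Sbd`. [folklore] -/
theorem le_mul_sBd_of_present (b : Bool) {A m Zmax Q : ℕ}
    (hne : ∀ j ≤ m, rC (genTime c rO A j) < rO (genTime c rO A j)) (hn : ∀ j ≤ m, rO (genTime c rO A j) ≤ n')
    (hZmax : ∀ j ≤ m, sAlive rO rC isS (genTime c rO A j) ≤ Zmax)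
    (hpres : ∀ j ≤ m, 0 < aliveS σ rO rC o (fun k => !isS k) b (genTime c rO A j))
    (hQ : Q ≤ ((Ico (rC A) (rO (genTime c rO A m))).filter fun k => isS k = true ∧ σ (o k) = !b).card) :
    Q ≤ Zmax * sBd σ o isS (rC A) (rO (genTime c rO A m)) := by
  classical
  -- pigeonhole: the `¬b`-S-items over the generations where `¬b` is present
  have h1 := card_filter_le_mul_card_gens hCs hc (fun k => isS k = true ∧ σ (o k) = !b) (Z := Zmax) hne hn
    (fun j hj => (card_le_card (s := (Ico _ _).filter _) (fun k hk => by
      rw [mem_filter] at hk ⊢; exact ⟨hk.1, hk.2.1⟩)).trans (hZmax j hj))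
  -- each such generation has both colours, hence an S-boundary inside
  have h2 : ((range (m + 1)).filter fun j => ∃ k ∈ Ico (rC (genTime c rO A j)) (rO (genTime c rO A j)),
      isS k = true ∧ σ (o k) = !b).card ≤
      ∑ j ∈ range (m + 1), sBd σ o isS (rC (genTime c rO A j)) (rO (genTime c rO A j)) := by
    rw [card_eq_sum_ones, sum_filter]
    refine sum_le_sum fun j hj => ?_
    split_ifs with h
    · obtain ⟨k, hk, hS, hcol⟩ := h
      have hb' : 0 < aliveS σ rO rC o (fun k => !isS k) (!b) (genTime c rO A j) := by
        unfold aliveS; exact card_pos.2 ⟨k, mem_filter.2 ⟨hk, by simpa using hS, hcol⟩⟩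
      exact one_le_sBd_of_two_colours b (hpres j (Nat.le_of_lt_succ (mem_range.1 hj))) hb'
    · exact Nat.zero_le _
  have h3 := sum_card_boundaries_le hOs hCs hc
    (fun k => isS k = true ∧ σ (o k) ≠ σ (o (Nat.findGreatest (fun n => isS n = true) (k - 1)))) hne hn
  unfold sBd at h2 ⊢
  calc Q ≤ _ := hQ
    _ ≤ Zmax * _ := h1
    _ ≤ Zmax * _ := Nat.mul_le_mul_left _ (h2.trans h3)

include hOs hCs ho hc in
/-- **Transfer cost.**  If at `T_{j₁}` no alive S-item has colour `b` and at a later `T_{j₂}` (`j₂ ≤ m`) all alive S-items have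
colour `b`, with both colours present strictly in between, then `#alive S at T_{j₂} ≤ tests[T_{j₁}, T_{j₂}) + D·(2·Sbd + 1)`.
[folklore] -/
theorem transfer_cost (b : Bool) {A m D : ℕ} {j₁ j₂ : ℕ} (hj : j₁ < j₂) (hj₂ : j₂ ≤ m)
    (hne : ∀ j ≤ m, rC (genTime c rO A j) < rO (genTime c rO A j)) (hn : ∀ j ≤ m, rO (genTime c rO A j) ≤ n')
    (hNS : ∀ t, A ≤ t → t < genTime c rO A m → W t = true → isS (rO t) = true → isS (rC t) = true)
    (hband : ∀ j < m, ∀ u v, genTime c rO A j ≤ u → u ≤ v → v ≤ genTime c rO A (j + 1) →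
      sPush W rO (fun k => !isS k) u v ≤ sPop W rC (fun k => !isS k) u v + D)
    (h₁ : aliveS σ rO rC o (fun k => !isS k) b (genTime c rO A j₁) = 0)
    (hmid : ∀ j, j₁ < j → j < j₂ → 0 < aliveS σ rO rC o (fun k => !isS k) b (genTime c rO A j) ∧
      0 < aliveS σ rO rC o (fun k => !isS k) (!b) (genTime c rO A j)) :
    aliveS σ rO rC o (fun k => !isS k) b (genTime c rO A j₂) ≤
      sTests W σ rO rC o (fun k => !isS k) (genTime c rO A j₁) (genTime c rO A j₂) +
        D * (2 * sBd σ o isS (rC A) (rO (genTime c rO A m)) + 1) := by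
  classical
  set T := genTime c rO A with hT
  -- time order of the generations
  have hTmono : ∀ i j, i ≤ j → j ≤ m + 1 → T i ≤ T j := by
    intro i j hij hjm
    induction j, hij using Nat.le_induction with
    | base => exact le_rfl
    | succ j hij ih => exact (ih (Nat.le_of_succ_le hjm)).trans (le_of_lt (genTime_lt_succ hc hne hn (Nat.le_of_lt_succ hjm)))
  -- growth summed from `j₁`
  have key : ∀ j, j₁ ≤ j → j ≤ j₂ →
      aliveS σ rO rC o (fun k => !isS k) b (T j) ≤ sTests W σ rO rC o (fun k => !isS k) (T j₁) (T j) +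
        D * ∑ i ∈ Ico j₁ j, (sBd σ o isS (rC (T i)) (rO (T i)) + 1) := by
    intro j hj₁ hjj₂
    induction j, hj₁ using Nat.le_induction with
    | base => rw [h₁]; exact Nat.zero_le _
    | succ j hj₁ ih =>
      have ih := ih (Nat.le_of_succ_le hjj₂)
      have hjm : j < m := lt_of_lt_of_le (Nat.lt_of_succ_le hjj₂) hj₂
      have hg := growthS_le hOs hCs ho hc (σ := σ) (isS := isS) b (T := T j) (D := D)
        (hne j (le_of_lt hjm)) (hn j (le_of_lt hjm)) (by rw [hT, ← genTime_succ]; exact hn (j + 1) hjm)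
        (fun t ht1 ht2 hW hS => hNS t ((hTmono 0 j (Nat.zero_le _) (by omega)).trans ht1)
          (lt_of_lt_of_le ht2 (by rw [hT, ← genTime_succ]; exact hTmono (j+1) m hjm (Nat.le_succ _))) hW hS)
        (fun u v hu huv hv => hband j hjm u v hu huv (by rw [hT, ← genTime_succ] at hv; exact hv))
      rw [hT, ← genTime_succ] at hg
      have hadd : sTests W σ rO rC o (fun k => !isS k) (T j₁) (T (j + 1)) =
          sTests W σ rO rC o (fun k => !isS k) (T j₁) (T j) + sTests W σ rO rC o (fun k => !isS k) (T j) (T (j + 1)) := by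
        unfold sTests
        exact card_filter_Ico_add _ (hTmono j₁ j hj₁ (by omega)) (hTmono j (j+1) (Nat.le_succ j) (by omega))
      have hg' : aliveS σ rO rC o (fun k => !isS k) b (T (j + 1)) ≤ aliveS σ rO rC o (fun k => !isS k) b (T j) +
          sTests W σ rO rC o (fun k => !isS k) (T j) (T (j + 1)) + D * (sBd σ o isS (rC (T j)) (rO (T j)) + 1) := hg
      rw [hadd, sum_Ico_succ_top hj₁, mul_add]
      linarith [hg', ih]
  have hk := key j₂ (le_of_lt hj) le_rfl
  -- the generations strictly between have an S-boundary inside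
  have hcount : ∑ i ∈ Ico j₁ j₂, (sBd σ o isS (rC (T i)) (rO (T i)) + 1) ≤
      2 * ∑ i ∈ Ico j₁ j₂, sBd σ o isS (rC (T i)) (rO (T i)) + 1 := by
    rw [sum_add_distrib, sum_const, Nat.card_Ico, smul_eq_mul, mul_one, two_mul, add_assoc]
    apply Nat.add_le_add_left
    -- `j₂ - j₁ ≤ Σ_{Ioo} sBd + 1 ≤ Σ_{Ico} sBd + 1`
    have h1 : ∑ i ∈ Ioo j₁ j₂, 1 ≤ ∑ i ∈ Ioo j₁ j₂, sBd σ o isS (rC (T i)) (rO (T i)) :=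
      sum_le_sum fun i hi => by
        have := hmid i (mem_Ioo.1 hi).1 (mem_Ioo.1 hi).2
        exact one_le_sBd_of_two_colours b this.1 this.2
    have h2 : ∑ i ∈ Ioo j₁ j₂, sBd σ o isS (rC (T i)) (rO (T i)) ≤ ∑ i ∈ Ico j₁ j₂, sBd σ o isS (rC (T i)) (rO (T i)) :=
      sum_le_sum_of_subset_of_nonneg (fun i hi => by rw [mem_Ioo] at hi; rw [mem_Ico]; omega) fun _ _ _ => Nat.zero_le _
    rw [sum_const, Nat.card_Ioo, smul_eq_mul, mul_one] at h1
    omega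
  -- and the boundaries inside distinct alive intervals are distinct
  have hsub : ∑ i ∈ Ico j₁ j₂, sBd σ o isS (rC (T i)) (rO (T i)) ≤ sBd σ o isS (rC A) (rO (T m)) := by
    have h3 := sum_card_boundaries_le hOs hCs hc
      (fun k => isS k = true ∧ σ (o k) ≠ σ (o (Nat.findGreatest (fun n => isS n = true) (k - 1)))) hne hn
    unfold sBd
    refine le_trans ?_ h3
    exact sum_le_sum_of_subset_of_nonneg (fun i hi => by rw [mem_Ico] at hi; rw [mem_range]; omega)
      fun _ _ _ => Nat.zero_le _
  calc aliveS σ rO rC o (fun k => !isS k) b (T j₂)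
      ≤ sTests W σ rO rC o (fun k => !isS k) (T j₁) (T j₂) + D * ∑ i ∈ Ico j₁ j₂, (sBd σ o isS (rC (T i)) (rO (T i)) + 1) := hk
    _ ≤ sTests W σ rO rC o (fun k => !isS k) (T j₁) (T j₂) + D * (2 * sBd σ o isS (rC A) (rO (T m)) + 1) := by
        apply Nat.add_le_add_left
        apply Nat.mul_le_mul_left
        omega

include hOs hCs ho hc in
/-- **Dichotomy (U4).**  Under NS, the S-band (`sPush ≤ sPop + D` on every window of every generation, `Zmin ≤ #alive S ≤ Zmax`
at every `T_j`) and free mass `Q` for both colours: either `Q ≤ Zmax · Sbd` or `Zmin ≤ tests[A, T_m) + D·(2·Sbd + 1)`. [folklore] -/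
theorem dichotomy {A m D Zmax Zmin Q : ℕ}
    (hne : ∀ j ≤ m, rC (genTime c rO A j) < rO (genTime c rO A j)) (hn : ∀ j ≤ m, rO (genTime c rO A j) ≤ n')
    (hNS : ∀ t, A ≤ t → t < genTime c rO A m → W t = true → isS (rO t) = true → isS (rC t) = true)
    (hband : ∀ j < m, ∀ u v, genTime c rO A j ≤ u → u ≤ v → v ≤ genTime c rO A (j + 1) →
      sPush W rO (fun k => !isS k) u v ≤ sPop W rC (fun k => !isS k) u v + D)
    (hZmax : ∀ j ≤ m, sAlive rO rC isS (genTime c rO A j) ≤ Zmax)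
    (hZmin : ∀ j ≤ m, Zmin ≤ sAlive rO rC isS (genTime c rO A j))
    (hQ : ∀ b : Bool, Q ≤ ((Ico (rC A) (rO (genTime c rO A m))).filter fun k => isS k = true ∧ σ (o k) = b).card) :
    Q ≤ Zmax * sBd σ o isS (rC A) (rO (genTime c rO A m)) ∨
      Zmin ≤ sTests W σ rO rC o (fun k => !isS k) A (genTime c rO A m) +
        D * (2 * sBd σ o isS (rC A) (rO (genTime c rO A m)) + 1) := by
  classical
  set T := genTime c rO A with hT
  by_cases hpres : ∃ b : Bool, ∀ j ≤ m, 0 < aliveS σ rO rC o (fun k => !isS k) b (T j)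
  · obtain ⟨b, hb⟩ := hpres
    exact Or.inl (le_mul_sBd_of_present hOs hCs hc b hne hn hZmax hb (hQ (!b)))
  · right
    push Not at hpres
    -- both an all-`false` and an all-`true` moment exist
    obtain ⟨i₁, hi₁m, hi₁⟩ := hpres true
    obtain ⟨i₂, hi₂m, hi₂⟩ := hpres false
    have hTmono : ∀ i j, i ≤ j → j ≤ m + 1 → T i ≤ T j := by
      intro i j hij hjm
      induction j, hij using Nat.le_induction with
      | base => exact le_rfl
      | succ j hij ih => exact (ih (Nat.le_of_succ_le hjm)).trans (le_of_lt (genTime_lt_succ hc hne hn (Nat.le_of_lt_succ hjm)))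
    -- generic transfer from an index with `aliveS b = 0` to a later index with `aliveS (!b) = 0`
    have main : ∀ (b : Bool) (i₁ i₂ : ℕ), i₁ < i₂ → i₂ ≤ m →
        aliveS σ rO rC o (fun k => !isS k) b (T i₁) = 0 → aliveS σ rO rC o (fun k => !isS k) (!b) (T i₂) = 0 →
        Zmin ≤ sTests W σ rO rC o (fun k => !isS k) A (T m) + D * (2 * sBd σ o isS (rC A) (rO (T m)) + 1) := by
      intro b i₁ i₂ hlt hi₂m h1 h2
      -- the FIRST all-`b` index `j₂` after `i₁`, then the LAST no-`b` index `j₁` before `j₂`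
      have hex₂ : ∃ j, i₁ < j ∧ j ≤ m ∧ aliveS σ rO rC o (fun k => !isS k) (!b) (T j) = 0 := ⟨i₂, hlt, hi₂m, h2⟩
      obtain ⟨hj₂1, hj₂2, hj₂3⟩ := Nat.find_spec hex₂
      have hmin₂ : ∀ j, i₁ < j → j < Nat.find hex₂ → aliveS σ rO rC o (fun k => !isS k) (!b) (T j) ≠ 0 :=
        fun j hj hjj h => Nat.find_min hex₂ hjj ⟨hj, (le_of_lt hjj).trans hj₂2, h⟩
      generalize hgen₂ : Nat.find hex₂ = j₂ at hj₂1 hj₂2 hj₂3 hmin₂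
      set P : ℕ → Prop := fun j => aliveS σ rO rC o (fun k => !isS k) b (T j) = 0 with hP
      have hF1 : P (Nat.findGreatest P (j₂ - 1)) := Nat.findGreatest_spec (P := P) (by omega) h1
      have hF2 : i₁ ≤ Nat.findGreatest P (j₂ - 1) := Nat.le_findGreatest (P := P) (by omega) h1
      have hF3 : Nat.findGreatest P (j₂ - 1) ≤ j₂ - 1 := Nat.findGreatest_le (j₂ - 1)
      have hF4 : ∀ j, P j → j ≤ j₂ - 1 → j ≤ Nat.findGreatest P (j₂ - 1) :=
        fun j hj hjle => Nat.le_findGreatest (P := P) hjle hj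
      generalize hgen₁ : Nat.findGreatest P (j₂ - 1) = j₁ at hF1 hF2 hF3 hF4
      have hj₁1 : aliveS σ rO rC o (fun k => !isS k) b (T j₁) = 0 := hF1
      have hmax₁ : ∀ j, j₁ < j → j < j₂ → aliveS σ rO rC o (fun k => !isS k) b (T j) ≠ 0 := by
        intro j hj hjj h
        have := hF4 j h (by omega)
        omega
      have hj₁j₂ : j₁ < j₂ := by omega
      have htc := transfer_cost hOs hCs ho hc b hj₁j₂ hj₂2 hne hn hNS hband hj₁1
        (fun j hj hjj => ⟨Nat.pos_of_ne_zero (hmax₁ j hj hjj), Nat.pos_of_ne_zero (hmin₂ j (by omega) hjj)⟩)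
      -- all alive S at `T j₂` have colour `b`
      have hall : aliveS σ rO rC o (fun k => !isS k) b (T j₂) = sAlive rO rC isS (T j₂) := by
        have := aliveS_add_aliveS (σ := σ) (rO := rO) (rC := rC) (o := o) (isS := isS) b (T j₂)
        rw [hj₂3, add_zero] at this; exact this
      have htests : sTests W σ rO rC o (fun k => !isS k) (T j₁) (T j₂) ≤ sTests W σ rO rC o (fun k => !isS k) A (T m) := by
        unfold sTests
        exact card_le_card (filter_subset_filter _ (Ico_subset_Ico (hTmono 0 j₁ (Nat.zero_le _) (by omega))
          (hTmono j₂ m hj₂2 (Nat.le_succ m))))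
      calc Zmin ≤ sAlive rO rC isS (T j₂) := hZmin j₂ hj₂2
        _ = aliveS σ rO rC o (fun k => !isS k) b (T j₂) := hall.symm
        _ ≤ _ := htc
        _ ≤ _ := Nat.add_le_add_right htests _
    rcases lt_trichotomy i₁ i₂ with h | h | h
    · exact main true i₁ i₂ h hi₂m (Nat.le_zero.1 hi₁) (by simpa using Nat.le_zero.1 hi₂)
    · -- both colours absent at the same index: no alive S-item, so `Zmin = 0`
      subst h
      have hsum := aliveS_add_aliveS (σ := σ) (rO := rO) (rC := rC) (o := o) (isS := isS) true (T i₁)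
      rw [Nat.le_zero.1 hi₁, Bool.not_true, Nat.le_zero.1 hi₂, zero_add] at hsum
      have := hZmin i₁ hi₁m
      rw [← hsum] at this
      omega
    · exact main false i₂ i₁ h hi₁m (Nat.le_zero.1 hi₂) (by simpa using Nat.le_zero.1 hi₁)

end AbstractQueue

end Summit.ValiantsHypothesis.ValiantsHypothesis.Theorems.FifoMatching.NNLinearDegreeCofactorHard.QueueHistory
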